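import Literature.NumberTheory.Automorphic.AdelicAdditiveCharacterDuality
import Literature.NumberTheory.Automorphic.TateLocalFactors
import HarnessLib

/-!
# Every local component `ψ_v` of Tate's character of `𝔸_K ⧸ K` is non-trivial

For a number field `K` and Tate's character `ψ_K` of `𝔸_K ⧸ K` (`adeleAddChar`), the local
component `ψ_v = ψ_K ∘ ι_v` (`adeleAddCharAt K v`) at a finite place `v` is a **non-trivial**
continuous additive character of `K_v` (`exists_adeleAddCharAt_ne_one`,
`isContinuousNontrivial_adeleAddCharAt`): its conductor is `𝔡_v⁻¹`, in particular finite
(Tate (1950/1967), Lemma 2.2.3 with §4.1; Weil, BNT, Ch. IV §2). The tree's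
`AdelicAdditiveCharacterDuality` proves the qualitative form "`ψ_v(𝔭_v⁻¹) ≠ 1` for almost all `v`"
(`finite_setOf_adeleAddCharAt_eq_one`); here the same codifferent argument, run with a pole of
order `m > ord_v(D)` instead of `1`, gives non-triviality at **every** `v`: if `ψ_v ≡ 1`, then for a
global `k` of exact `v`-order `-m` and integral elsewhere all `𝓞 K`-multiples of `k` have integral
trace, so `D k` is integral for a denominator `D` of the codifferent
(`exists_denominator_codifferent`), forcing `|D k|_v ≤ 1`, i.e. `m ≤ ord_v(D)`. This is the
non-degeneracy of the local characters entering the local uniqueness of Whittaker functionals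
(`rank_whittakerFunctionals_le_one_holds`). Theorems only; no named fact.

## References

* J. Tate, *Fourier analysis in number fields and Hecke's zeta-functions*, in Cassels–Fröhlich
  (eds.), *Algebraic Number Theory* (1967), Ch. XV, Lemma 2.2.3, §4.1. [CasselsFrohlichANT1967]
* A. Weil, *Basic Number Theory* (1967), Ch. IV §2 (the character of `K_v` is non-trivial).
-/

noncomputable section

open NumberField IsDedekindDomain

namespace Literature.NumberTheory.Automorphic

section Nontrivial

open scoped Classical

variable (K : Type) [Field K] [NumberField K]

/-- `exp(1)^m = exp(m)` in `ℤᵐ⁰`. [folklore] -/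
private theorem withZero_exp_one_pow (m : ℕ) :
    (WithZero.exp (1 : ℤ)) ^ m = WithZero.exp (m : ℤ) := by
  induction m with
  | zero => rw [pow_zero, Nat.cast_zero, WithZero.exp_zero]
  | succ m ih => rw [pow_succ, ih, ← WithZero.exp_add, Nat.cast_succ]

/-- **Every local component `ψ_v` of Tate's character is non-trivial**: for every finite place `v`
there is `u ∈ K_v` with `ψ_v(u) ≠ 1` (Tate, Lemma 2.2.3: the conductor of `ψ_v` is `𝔡_v⁻¹`; Weil,
BNT IV §2). Codifferent argument with a pole of order exceeding `ord_v(D)`, `D` a denominator of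
the codifferent. [cite: CasselsFrohlichANT1967, Ch. XV (Tate), Lemma 2.2.3] -/
theorem exists_adeleAddCharAt_ne_one (v : HeightOneSpectrum (𝓞 K)) :
    ∃ u : v.adicCompletion K, adeleAddCharAt K v u ≠ 1 := by
  by_contra hall
  push Not at hall
  obtain ⟨D, hD0, hD⟩ := exists_denominator_codifferent K
  set V : Valuation (v.adicCompletion K) (WithZero (Multiplicative ℤ)) := Valued.v with hV
  have hval : ∀ k : K, V (k : v.adicCompletion K) = v.valuation K k := fun k =>
    HeightOneSpectrum.valuedAdicCompletion_eq_valuation' v k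
  -- the order of `D` at `v`
  have hDne : v.valuation K (D : K) ≠ 0 := by
    rw [Valuation.ne_zero_iff]
    exact_mod_cast hD0
  set z : ℤ := WithZero.log (v.valuation K (D : K)) with hz
  have hDz : v.valuation K (D : K) = WithZero.exp z := (WithZero.exp_log hDne).symm
  have hzle : z ≤ 0 := by
    have h1 : v.valuation K (D : K) ≤ 1 := HeightOneSpectrum.valuation_le_one v D
    rwa [hDz, ← WithZero.exp_zero, WithZero.exp_le_exp] at h1
  -- a pole order `m > ord_v(D) = -z`
  set m : ℕ := (1 - z).toNat with hm
  have hm' : (m : ℤ) = 1 - z := Int.toNat_of_nonneg (by omega)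
  have hm1 : (1 : ℤ) ≤ m := by omega
  -- a global element of exact `v`-order `-m`, integral elsewhere
  obtain ⟨π, hπ⟩ := v.valuation_exists_uniformizer K
  set x : K := π⁻¹ ^ m with hx
  have hxv : V (x : v.adicCompletion K) = WithZero.exp (m : ℤ) := by
    rw [hval, hx, map_pow, map_inv₀, hπ, ← WithZero.exp_neg, neg_neg, withZero_exp_one_pow]
  obtain ⟨k, hk⟩ := exists_isFiniteIntegral_sub_algebraMap K
    (adeleSingleHom K v (x : v.adicCompletion K))
  have hkw : ∀ w : HeightOneSpectrum (𝓞 K), w ≠ v →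
      (k : w.adicCompletion K) ∈ w.adicCompletionIntegers K := by
    intro w hw
    have := hk w
    change (adeleSingleHom K v (x : v.adicCompletion K)).2 w -
      (algebraMap K (AdeleRing (𝓞 K) K) k).2 w ∈ _ at this
    rw [adeleSingleHom_apply_snd, finiteAdeleSingleHom_apply_of_ne K v _ hw, zero_sub,
      AdeleRing.algebraMap_snd] at this
    simpa using neg_mem this
  have hkv : V ((x : v.adicCompletion K) - (k : v.adicCompletion K)) ≤ 1 := by
    have := hk v
    change (adeleSingleHom K v (x : v.adicCompletion K)).2 v -
      (algebraMap K (AdeleRing (𝓞 K) K) k).2 v ∈ _ at this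
    rw [adeleSingleHom_apply_snd, finiteAdeleSingleHom_apply_self, AdeleRing.algebraMap_snd] at this
    exact (HeightOneSpectrum.mem_adicCompletionIntegers (𝓞 K) K v).1 this
  have h1m : (1 : WithZero (Multiplicative ℤ)) ≤ WithZero.exp (m : ℤ) := by
    rw [← WithZero.exp_zero]
    exact WithZero.exp_le_exp.2 (by omega)
  have h1m' : (1 : WithZero (Multiplicative ℤ)) < WithZero.exp (m : ℤ) := by
    rw [← WithZero.exp_zero]
    exact WithZero.exp_lt_exp.2 (by omega)
  -- `|k|_v = q_v^m` exactly
  have hk_le : V (k : v.adicCompletion K) ≤ WithZero.exp (m : ℤ) := by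
    have := V.map_sub (x : v.adicCompletion K)
      ((x : v.adicCompletion K) - (k : v.adicCompletion K))
    rw [sub_sub_cancel] at this
    exact this.trans (max_le hxv.le (hkv.trans h1m))
  have hk_ge : WithZero.exp (m : ℤ) ≤ V (k : v.adicCompletion K) := by
    by_contra hlt
    have := V.map_add ((x : v.adicCompletion K) - (k : v.adicCompletion K))
      (k : v.adicCompletion K)
    rw [sub_add_cancel, hxv] at this
    exact absurd this (not_le.2 (max_lt (lt_of_le_of_lt hkv h1m') (not_le.1 hlt)))
  -- all `𝓞 K`-multiples of `k` have integral trace, since `ψ_v ≡ 1`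
  have htr : ∀ u : 𝓞 K, ∃ n : ℤ, (n : ℚ) = Algebra.trace ℚ K ((u : K) * k) := by
    intro u
    have h1 : adeleAddCharAt K v (((u : K) * k : K) : v.adicCompletion K) = 1 := hall _
    rw [adeleAddCharAt_eq_of_sub_mem K v (k := (u : K) * k) (by simp)
      (fun w hw => by
        rw [HeightOneSpectrum.adicCompletion.coe_mul]
        exact mul_mem (HeightOneSpectrum.coe_algebraMap_mem (𝓞 K) K w u) (hkw w hw)),
      ← AddCircle.toCircle_zero, (AddCircle.injective_toCircle one_ne_zero).eq_iff,
      AddCircle.coe_eq_zero_iff] at h1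
    obtain ⟨n, hn⟩ := h1
    refine ⟨n, ?_⟩
    have : ((n : ℚ) : ℝ) = ((Algebra.trace ℚ K ((u : K) * k) : ℚ) : ℝ) := by
      rw [← hn, zsmul_eq_mul, mul_one, Rat.cast_intCast]
    exact_mod_cast this
  -- hence `D k` is integral, i.e. `|D|_v |k|_v ≤ 1`: contradiction with `m > ord_v(D)`
  obtain ⟨r, hr⟩ := hD k htr
  have hDk : V ((((D : K) * k) : K) : v.adicCompletion K) ≤ 1 := by
    rw [← hr, hval]
    exact HeightOneSpectrum.valuation_le_one v r
  rw [HeightOneSpectrum.adicCompletion.coe_mul, map_mul, hval, hDz] at hDk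
  have h2 : WithZero.exp z * WithZero.exp (m : ℤ) ≤ 1 :=
    le_trans (mul_le_mul le_rfl hk_ge zero_le zero_le) hDk
  rw [← WithZero.exp_add, ← WithZero.exp_zero, WithZero.exp_le_exp] at h2
  omega

/-- **`ψ_v` is a non-trivial continuous character of `K_v`** (`AddChar.IsContinuousNontrivial`), for
every finite place `v` (Tate, Lemma 2.2.3 / §4.1; Weil, BNT IV §2) — the hypothesis on the additive
character in the local uniqueness of Whittaker functionals. [cite: CasselsFrohlichANT1967, Ch. XV (Tate), Lemma 2.2.3] -/
theorem isContinuousNontrivial_adeleAddCharAt (v : HeightOneSpectrum (𝓞 K)) :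
    (adeleAddCharAt K v).IsContinuousNontrivial := by
  refine ⟨continuous_adeleAddCharAt K v, fun h0 => ?_⟩
  obtain ⟨u, hu⟩ := exists_adeleAddCharAt_ne_one K v
  exact hu (by rw [h0, AddChar.zero_apply])

end Nontrivial

end Literature.NumberTheory.Automorphic
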